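import Summits.Langlands.Langlands.Theorems.SectorComplement.Negative.EisensteinGelfandKirillovSectorComplementPosition

/-!
# Route EisensteinGelfandKirillov — `SectorComplement` (stmt-Langlands-18275): logical position, positive side

`SectorComplement := ReducibleCrystallineModular → Langlands` is the route's declared COMPLEMENT OF THE
SECTOR (D-0027 §2.2 convention): the fourth hypothesis of the deciding theorem
`Theses.EisensteinGelfandKirillov.closes : EisensteinGKBound → ProModularOfGKBound →
CrystallineProModularClassical → SectorComplement → Langlands`, filed only so that `closes` ends in
the summit constant by name, and declared "not attacked, not expected to close before the summit".

The disprover's landed file `Theorems/SectorComplement/Negative/EisensteinGelfandKirillovSectorComplementPosition.lean`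
(p142902) records the NEGATIVE-side bookkeeping (`¬ C ↔ X ∧ ¬ Langlands`, `¬ X → ¬ Langlands`, truth
table).  This file adds the POSITIVE-side identities a refuter file may not state (D-0016), none of which
asserts the item, the target or the summit (5 theorems):

* (`Langlands → SectorComplement` is `fun h _ ↦ h`, the landed `skinnerWilesDefectOne_sectorComplement_of_langlands`
  pattern; not restated);
* `eisensteinGelfandKirillov_reducibleCrystallineModular_of_langlands`: `Langlands → X` — the EGK sector
  is INSIDE the summit as typed (contrapositive of the landed `¬ X → ¬ Langlands`: direction (B) at
  `n = 2`, `ℓ = p`, crystalline for the pinned datum ⇒ de Rham);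
* `eisensteinGelfandKirillov_langlands_iff_target_and_sectorComplement`: the exact bookkeeping identity
  `Langlands ↔ X ∧ SectorComplement` — target and declared complement partition the summit with no
  typing drift (NOT derivable for the sibling ordinary sector `SkinnerWilesDefectOne`, whose target's
  "ordinary" hypothesis is not an axiom of the abstract `D_pst` datum);
* `eisensteinGelfandKirillov_sectorComplement_iff_of_target`: under X, `SectorComplement ↔ Langlands`;
* `eisensteinGelfandKirillov_reducibleCrystallineModular_of_cruxes`: door + engine + exit give X (the
  inner step of `closes`, isolated as a glue edge);
* `eisensteinGelfandKirillov_sectorComplement_iff_of_cruxes`: under door + engine + exit,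
  `SectorComplement ↔ Langlands` — once the route's own cruxes land, this item IS the summit.

Only modus ponens, the landed negative lemma and the route's `closes` are used, so every statement is
agnostic to the exact shape of `_root_.Langlands` (re-typed to the `∀ 𝓡` form on 2026-08-17, p141787).
-/

set_option linter.dupNamespace false -- project-wide option; `Summit.Langlands.Langlands` is the mandated namespace

namespace Summit.Langlands.Langlands.Theorems

open Summit.Langlands.Langlands.Theses.EisensteinGelfandKirillov

/-- **The EGK sector is inside the summit as typed**: `Langlands → ReducibleCrystallineModular`
(contrapositive of the landed `eisensteinGelfandKirillov_not_langlands_of_not_target`). [folklore] -/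
theorem eisensteinGelfandKirillov_reducibleCrystallineModular_of_langlands (hL : _root_.Langlands) :
    ReducibleCrystallineModular :=
  Classical.byContradiction fun hX ↦ eisensteinGelfandKirillov_not_langlands_of_not_target hX hL

/-- **Exact bookkeeping identity**: `Langlands ↔ ReducibleCrystallineModular ∧ SectorComplement` — the
route target and its declared complement partition the summit, with no typing drift. [folklore] -/
theorem eisensteinGelfandKirillov_langlands_iff_target_and_sectorComplement : _root_.Langlands ↔ Summit.Langlands.Langlands.Theses.EisensteinGelfandKirillov.ReducibleCrystallineModular ∧ Summit.Langlands.Langlands.Theses.EisensteinGelfandKirillov.SectorComplement :=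
  ⟨fun h ↦ ⟨eisensteinGelfandKirillov_reducibleCrystallineModular_of_langlands h, fun _ ↦ h⟩,
    fun h ↦ h.2 h.1⟩

/-- Under the route TARGET `ReducibleCrystallineModular`, the frame is literally the summit:
`SectorComplement ↔ Langlands`. [folklore] -/
theorem eisensteinGelfandKirillov_sectorComplement_iff_of_target (hX : ReducibleCrystallineModular) :
    SectorComplement ↔ _root_.Langlands :=
  ⟨fun hC ↦ hC hX, fun h _ ↦ h⟩

/-- The inner step of the route's deciding theorem, isolated: the door `EisensteinGKBound`, the
engine `ProModularOfGKBound` and the exit `CrystallineProModularClassical` give the target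
`ReducibleCrystallineModular` (the target's local hypothesis at `v ∣ p` splits into
`p`-distinguishedness for the engine and crystalline + Hodge–Tate-regular for the exit). [folklore] -/
theorem eisensteinGelfandKirillov_reducibleCrystallineModular_of_cruxes (h₂ : EisensteinGKBound)
    (h₃ : ProModularOfGKBound) (h₄ : CrystallineProModularClassical) : ReducibleCrystallineModular := by
  intro F _ _ hF p _ hp hdisc O hO hcpt ι ρ ρ₀ hirr hodd hur hup hloc
  have hpm := h₃ h₂ F hF p hp hdisc O hO ρ ρ₀ hirr hodd hur hup (fun v hv => (hloc v hv).1)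
  exact h₄ F hF p hp hdisc hcpt ι ρ hirr hodd hur hpm (fun v hv => ⟨(hloc v hv).2.1, (hloc v hv).2.2⟩)

/-- Under the other three hypotheses of the deciding theorem — the door `EisensteinGKBound`, the
engine `ProModularOfGKBound` and the exit `CrystallineProModularClassical` — the frame is equivalent
to the summit: `SectorComplement ↔ Langlands` (`→` is the route's sorry-free `closes`). So this item
can close only together with the summit once the route's cruxes land. [folklore] -/
theorem eisensteinGelfandKirillov_sectorComplement_iff_of_cruxes (h₂ : EisensteinGKBound)
    (h₃ : ProModularOfGKBound) (h₄ : CrystallineProModularClassical) :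
    SectorComplement ↔ _root_.Langlands :=
  ⟨fun hC ↦ closes h₂ h₃ h₄ hC, fun h _ ↦ h⟩

end Summit.Langlands.Langlands.Theorems
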